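import Literature.NumberTheory.Transcendental.Waldschmidt1980SizesB
import HarnessLib

/-!
# Waldschmidt 1980, Prop. 3.8 over `ℚ` (`q = 2`): the numerical inequalities

Support file (plain definitions and theorems; no named facts) for the archimedean input of the
Stewart–Yu 1991 line of `Literature.Barriers.ABC.stewartYu1991_upperBound` (M. Waldschmidt,
*A lower bound for linear forms in logarithms*, Acta Arith. **37** (1980), Prop. 3.8 over `ℚ`,
`q = 2`); sequel to `Waldschmidt1980SizesB.lean`.

The bookkeeping of Lemmas 3.5–3.7 in the unit `𝔘 = U/2ᵐ`: at level `J`, step `k` (points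
`s < 2^{k+J} S₀`, `kpts = 2^{k+J} S₀/2` interpolation nodes of multiplicity `t_J = ⌊(T/2ᴶ)/(2m)⌋`)
one has `2ᵏ 𝔘/5 ≤ kpts · t_J ≤ 2ᵏ 𝔘/4`, hence the Hermite cost `(28e)^{kpts t} ≤ exp(1.085 · 2ᵏ𝔘)`
and the gain `(1/21)^{kpts t} ≤ exp(−0.6 · 2ᵏ 𝔘)`; with all the moderate quantities `≤ 𝔅 = e^{𝔘/64}`
this gives the final inequalities `final_kstep` (integer points, against `1/D`) and `final_half`
(half-integer points, against the Liouville bound `M/(4DMP²)^{2^m}`).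

## References

* [Waldschmidt1980] M. Waldschmidt, *A lower bound for linear forms in logarithms*, Acta Arith. 37
  (1980), 257–283 — §3.4, Lemmas 3.5–3.7 (pp. 270–273).
-/

noncomputable section

open Finset Real
open Literature.NumberTheory.Transcendental.CW77

namespace Literature.NumberTheory.Transcendental.Waldschmidt1980.W80Par

variable {d : ℕ} (P : W80Par d)

/-! ### The inner step size `t_J = ⌊(T/2ᴶ)/(2m)⌋` -/

/-- `t_J = ⌊(T/2ᴶ)/(2m)⌋`: the number of derivatives given up at each of the `m` inner steps of
level `J` (Waldschmidt's `(1 − k/2n) q^{−J} T`, Lemma 3.6). [cite: Waldschmidt1980, Lemma 3.6 (p. 272)] -/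
def tJ (J : ℕ) : ℕ := P.T / 2 ^ J / (2 * (d + 1))

/-- `2^J ≤ L_θ` for `J < J₀` (`2^{J₀} ≤ 2 L_θ`). [folklore] -/
theorem two_pow_le_Lθ {J : ℕ} (hJ : J < P.J₀) : 2 ^ J ≤ P.Lθ := by
  have h := P.two_pow_le
  have : 2 ^ (J + 1) ≤ 2 ^ P.J₀ := Nat.pow_le_pow_right two_pos hJ
  rw [pow_succ] at this
  omega

/-- **`T/2ᴶ ≥ 2¹¹ m²`** for `J < J₀` (`T ≥ 2¹¹ m² V_θ L_θ ≥ 2¹¹ m² 2ᴶ`). [folklore] -/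
theorem TJ_ge {J : ℕ} (hJ : J < P.J₀) : 2 ^ 11 * (d + 1) ^ 2 ≤ P.T / 2 ^ J := by
  rw [Nat.le_div_iff_mul_le (Nat.pow_pos two_pos)]
  have h := P.T_ge_Lθ
  have hL := P.two_pow_le_Lθ hJ
  have hV := P.one_le_Vθ
  have : ((2 ^ 11 * (d + 1) ^ 2 * 2 ^ J : ℕ) : ℝ) ≤ P.T := by
    refine le_trans ?_ h
    have hL' : ((2 : ℝ) ^ J) ≤ P.Lθ := by exact_mod_cast hL
    have e : ((2 ^ 11 * (d + 1) ^ 2 * 2 ^ J : ℕ) : ℝ) = 2 ^ 11 * mR d ^ 2 * 2 ^ J := by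
      unfold mR; push_cast; ring
    rw [e]
    have h0 : (0 : ℝ) ≤ 2 ^ 11 * mR d ^ 2 := by positivity
    have hL0 : (0 : ℝ) ≤ P.Lθ := Nat.cast_nonneg _
    calc (2 : ℝ) ^ 11 * mR d ^ 2 * 2 ^ J = 2 ^ 11 * mR d ^ 2 * 1 * 2 ^ J := by ring
      _ ≤ 2 ^ 11 * mR d ^ 2 * P.Vθ * P.Lθ :=
          mul_le_mul (mul_le_mul_of_nonneg_left hV h0) hL' (by positivity) (mul_nonneg h0 (by linarith))
  exact_mod_cast this

/-- `1 ≤ t_J` for `J < J₀`. [folklore] -/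
theorem one_le_tJ {J : ℕ} (hJ : J < P.J₀) : 1 ≤ P.tJ J := by
  unfold tJ
  rw [Nat.le_div_iff_mul_le (by omega)]
  have := P.TJ_ge hJ
  nlinarith

/-- `2m · t_J ≤ T/2ᴶ`. [folklore] -/
theorem tJ_mul_le (J : ℕ) : 2 * (d + 1) * P.tJ J ≤ P.T / 2 ^ J := by
  unfold tJ; rw [Nat.mul_comm]; exact Nat.div_mul_le_self _ _

/-- `t_J ≤ T`. [folklore] -/
theorem tJ_le_T (J : ℕ) : P.tJ J ≤ P.T :=
  ((Nat.div_le_self _ _).trans (Nat.div_le_self _ _))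

/-- `t_J ≤ T/(2ᴶ · 2m)` (real). [folklore] -/
theorem tJ_le_real (J : ℕ) : (P.tJ J : ℝ) ≤ P.T / (2 ^ J * (2 * mR d)) := by
  have h1 : ((P.tJ J : ℕ) : ℝ) ≤ ((P.T / 2 ^ J : ℕ) : ℝ) / (2 * mR d) := by
    unfold tJ
    have := Nat.cast_div_le (α := ℝ) (m := P.T / 2 ^ J) (n := 2 * (d + 1))
    have em : ((2 * (d + 1) : ℕ) : ℝ) = 2 * mR d := by unfold mR; push_cast; ring
    rwa [em] at this
  have h2 : ((P.T / 2 ^ J : ℕ) : ℝ) ≤ (P.T : ℝ) / 2 ^ J := by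
    have := Nat.cast_div_le (α := ℝ) (m := P.T) (n := 2 ^ J)
    push_cast at this; exact this
  have hm := mR_pos P
  calc (P.tJ J : ℝ) ≤ ((P.T / 2 ^ J : ℕ) : ℝ) / (2 * mR d) := h1
    _ ≤ ((P.T : ℝ) / 2 ^ J) / (2 * mR d) := div_le_div_of_nonneg_right h2 (by positivity)
    _ = P.T / (2 ^ J * (2 * mR d)) := by rw [div_div]

omit P in
/-- `⌊a/b⌋ ≥ a/b − 1` for naturals, as reals. [folklore] -/
theorem natDiv_ge_real (a b : ℕ) (hb : 0 < b) : (a : ℝ) / b - 1 ≤ ((a / b : ℕ) : ℝ) := by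
  have h := Nat.lt_div_mul_add hb (a := a)
  have hb' : (0 : ℝ) < b := by exact_mod_cast hb
  rw [div_sub_one hb'.ne', div_le_iff₀ hb']
  have : (a : ℝ) < (a / b : ℕ) * b + b := by exact_mod_cast h
  linarith

/-- `t_J ≥ T/(2ᴶ · 2m) − 2` (real). [folklore] -/
theorem tJ_ge_real (J : ℕ) : (P.T : ℝ) / (2 ^ J * (2 * mR d)) - 2 ≤ P.tJ J := by
  have hm := mR_pos P
  have h1 := natDiv_ge_real (P.T / 2 ^ J) (2 * (d + 1)) (by omega)
  have h2 := natDiv_ge_real P.T (2 ^ J) (Nat.pow_pos two_pos)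
  have em : ((2 * (d + 1) : ℕ) : ℝ) = 2 * mR d := by unfold mR; push_cast; ring
  rw [em] at h1
  push_cast at h2
  unfold tJ
  have h3 : ((P.T : ℝ) / 2 ^ J - 1) / (2 * mR d) ≤ ((P.T / 2 ^ J : ℕ) : ℝ) / (2 * mR d) :=
    div_le_div_of_nonneg_right h2 (by positivity)
  have h4 : (P.T : ℝ) / (2 ^ J * (2 * mR d)) - 2 ≤ ((P.T : ℝ) / 2 ^ J - 1) / (2 * mR d) - 1 := by
    rw [← div_div, sub_div]
    have : 1 / (2 * mR d) ≤ 1 := by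
      rw [div_le_one (by positivity)]; linarith [two_le_mR P]
    linarith
  linarith

/-- `T ≥ 𝔘/(c_T W⋆) − 1` (real). [folklore] -/
theorem T_ge_real : P.𝔘 / (cT * P.Wstar) - 1 ≤ P.T := by
  unfold T
  have e : P.U / (cT * 2 ^ (d + 1) * P.Wstar) = P.𝔘 / (cT * P.Wstar) := by
    rw [P.U_eq]; unfold cT; field_simp
  rw [e]
  have h1 := Nat.lt_floor_add_one (P.𝔘 / (cT * P.Wstar))
  linarith

/-! ### The interpolation nodes `kpts = 2^{k+J} S₀ / 2` -/

/-- `2^{k+J} S₀ / 2 = 2^{k+J} ⌊c_S m W⋆⌋` exactly (`S₀` is even). [folklore] -/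
theorem kpts_eq (J k : ℕ) : 2 ^ (k + J) * P.S₀ / 2 = 2 ^ (k + J) * ⌊cS * mR d * P.Wstar⌋₊ := by
  unfold S₀
  rw [show 2 ^ (k + J) * (2 * ⌊cS * mR d * P.Wstar⌋₊) = 2 ^ (k + J) * ⌊cS * mR d * P.Wstar⌋₊ * 2 by ring,
    Nat.mul_div_cancel _ two_pos]

/-- `kpts ≤ 2^{k+J} c_S m W⋆` (real). [folklore] -/
theorem kpts_le_real (J k : ℕ) : ((2 ^ (k + J) * P.S₀ / 2 : ℕ) : ℝ) ≤ 2 ^ (k + J) * (cS * mR d * P.Wstar) := by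
  rw [P.kpts_eq]; push_cast
  have := Nat.floor_le (show 0 ≤ cS * mR d * P.Wstar by have := P.cS_mul_ge; linarith)
  gcongr

/-- `kpts ≥ 2^{k+J} (c_S m W⋆ − 1)` (real). [folklore] -/
theorem kpts_ge_real (J k : ℕ) : 2 ^ (k + J) * (cS * mR d * P.Wstar - 1) ≤ ((2 ^ (k + J) * P.S₀ / 2 : ℕ) : ℝ) := by
  rw [P.kpts_eq]; push_cast
  have := (Nat.lt_floor_add_one (cS * mR d * P.Wstar)).le
  have h0 : (0 : ℝ) ≤ 2 ^ (k + J) := by positivity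
  nlinarith

/-- `kpts ≤ 2^{d+J₀} S₀` for `k ≤ d`, `J ≤ J₀`. [folklore] -/
theorem kpts_le_nat {J k : ℕ} (hJ : J ≤ P.J₀) (hk : k ≤ d) : 2 ^ (k + J) * P.S₀ / 2 ≤ 2 ^ (d + P.J₀) * P.S₀ :=
  (Nat.div_le_self _ _).trans (Nat.mul_le_mul_right _ (Nat.pow_le_pow_right two_pos (by omega)))

/-- **Upper bound `kpts · t_J ≤ 2ᵏ 𝔘/4`** (`c_S/c_T = 1/2`). [cite: Waldschmidt1980, Lemma 3.5 (p. 271)] -/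
theorem KT_le (J k : ℕ) : ((2 ^ (k + J) * P.S₀ / 2 : ℕ) : ℝ) * (P.tJ J : ℝ) ≤ 2 ^ k * P.𝔘 / 4 := by
  have h1 := P.kpts_le_real J k
  have h2 := P.tJ_le_real J
  have hm := mR_pos P; have hW := P.one_le_Wstar; have hT := P.T_pos; have hTW := P.TWstar_le
  have h0 : (0 : ℝ) ≤ ((2 ^ (k + J) * P.S₀ / 2 : ℕ) : ℝ) := Nat.cast_nonneg _
  have hW0 : 0 < P.Wstar := by linarith
  have hcS0 : (0 : ℝ) < cS := by unfold cS; norm_num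
  calc ((2 ^ (k + J) * P.S₀ / 2 : ℕ) : ℝ) * (P.tJ J : ℝ)
      ≤ (2 ^ (k + J) * (cS * mR d * P.Wstar)) * (P.T / (2 ^ J * (2 * mR d))) :=
        mul_le_mul h1 h2 (Nat.cast_nonneg _) (by positivity)
    _ = 2 ^ k * cS * (P.T * P.Wstar) / 2 := by
        rw [pow_add]; field_simp
    _ ≤ 2 ^ k * cS * (P.𝔘 / cT) / 2 := by gcongr
    _ = 2 ^ k * P.𝔘 / 4 := by unfold cS cT; ring

/-- **Lower bound `kpts · t_J ≥ 2ᵏ 𝔘/5`** for `J < J₀`. [cite: Waldschmidt1980, Lemma 3.5 (p. 271)] -/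
theorem KT_ge {J : ℕ} (hJ : J < P.J₀) (k : ℕ) :
    2 ^ k * P.𝔘 / 5 ≤ ((2 ^ (k + J) * P.S₀ / 2 : ℕ) : ℝ) * (P.tJ J : ℝ) := by
  have h1 := P.kpts_ge_real J k
  have h2 := P.tJ_ge_real J
  have h3 := P.T_ge_real
  have hm := mR_pos P; have hm2 := two_le_mR P; have hW := P.one_le_Wstar; have hU := P.𝔘_pos
  have hcS := P.cS_mul_ge
  have hWU := P.Wstar_le_𝔘
  -- `2^{J+1} c_S m W⋆ ≤ 𝔘/2^{13}` : `2^{J} ≤ Lθ ≤ 𝔘/(2^14 S₀)` and `S₀ ≥ c_S m W⋆`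
  have hJL : (2 : ℝ) ^ J ≤ P.Lθ := by exact_mod_cast P.two_pow_le_Lθ hJ
  have hLS := P.LθS₀_le
  have hS₀ := P.S₀_ge
  have hsmall : (2 : ℝ) ^ J * (cS * mR d * P.Wstar) ≤ P.𝔘 / 2 ^ 14 := by
    calc (2 : ℝ) ^ J * (cS * mR d * P.Wstar) ≤ P.Lθ * P.S₀ := mul_le_mul hJL hS₀ (by linarith) (Nat.cast_nonneg _)
      _ ≤ P.𝔘 / 2 ^ 14 := hLS
  have ht0 : (0 : ℝ) ≤ P.tJ J := Nat.cast_nonneg _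
  -- `2^J t_J ≥ T/(2m) − 2^{J+1}`
  have h2J : (0 : ℝ) < 2 ^ J := by positivity
  have h2' : (P.T : ℝ) / (2 * mR d) - 2 * 2 ^ J ≤ 2 ^ J * (P.tJ J : ℝ) := by
    have := mul_le_mul_of_nonneg_left h2 h2J.le
    have e : (2 : ℝ) ^ J * (P.T / (2 ^ J * (2 * mR d)) - 2) = P.T / (2 * mR d) - 2 * 2 ^ J := by
      field_simp
    linarith
  -- the main term: `(A − 1)(𝔘/(c_T W⋆) − 1)/(2m) ≥ 𝔘/4 − c_S W⋆/2 − 𝔘/(2m c_T W⋆)` with `A = c_S m W⋆`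
  set A : ℝ := cS * mR d * P.Wstar with hA
  have hA1 : 1 ≤ A := le_trans (by norm_num) hcS
  have eA : A * (P.𝔘 / (cT * P.Wstar)) = mR d * P.𝔘 / 2 := by
    rw [hA]; unfold cS cT; field_simp
  have hmain : P.𝔘 / 5 ≤ (A - 1) * (P.T / (2 * mR d) - 2 * 2 ^ J) := by
    -- (a) `(A-1) T/(2m) ≥ (A-1)(𝔘/(c_T W⋆) - 1)/(2m)`
    have ha : (A - 1) * ((P.𝔘 / (cT * P.Wstar) - 1) / (2 * mR d)) ≤ (A - 1) * (P.T / (2 * mR d)) :=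
      mul_le_mul_of_nonneg_left (div_le_div_of_nonneg_right h3 (by positivity)) (by linarith)
    -- (b) expand `(A-1)(𝔘/(c_T W⋆) - 1) = A 𝔘/(c_T W⋆) - A - 𝔘/(c_T W⋆) + 1`
    have hb : (A - 1) * ((P.𝔘 / (cT * P.Wstar) - 1) / (2 * mR d)) =
        (mR d * P.𝔘 / 2 - A - P.𝔘 / (cT * P.Wstar) + 1) / (2 * mR d) := by
      rw [← eA]; ring
    -- (c) the pieces
    have hc1 : (mR d * P.𝔘 / 2 - A - P.𝔘 / (cT * P.Wstar) + 1) / (2 * mR d) =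
        P.𝔘 / 4 - A / (2 * mR d) - P.𝔘 / (cT * P.Wstar) / (2 * mR d) + 1 / (2 * mR d) := by
      field_simp
      ring
    have hc2 : A / (2 * mR d) = cS * P.Wstar / 2 := by rw [hA]; field_simp
    have hc3 : P.𝔘 / (cT * P.Wstar) / (2 * mR d) ≤ P.𝔘 / 2 ^ 16 := by
      rw [div_div, div_le_div_iff₀ (by unfold cT; positivity) (by norm_num)]
      unfold cT
      have : (2 : ℝ) ^ 16 ≤ 2 ^ 14 * P.Wstar * (2 * mR d) := by nlinarith
      nlinarith
    have hc4 : 0 ≤ 1 / (2 * mR d) := by positivity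
    have hWs : cS * P.Wstar / 2 ≤ P.𝔘 / 2 ^ 86 := by
      unfold cS; rw [div_le_div_iff₀ (by norm_num) (by norm_num)]; nlinarith
    -- (d) `(A-1) · 2 · 2^J ≤ 2 · 2^J A ≤ 𝔘/2^13`
    have hd : (A - 1) * (2 * 2 ^ J) ≤ P.𝔘 / 2 ^ 13 := by
      have : (A - 1) * (2 * 2 ^ J) ≤ 2 * (2 ^ J * A) := by nlinarith
      have h14 : 2 * (P.𝔘 / 2 ^ 14) = P.𝔘 / 2 ^ 13 := by ring
      rw [hA] at this ⊢; linarith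
    have htot : (A - 1) * (P.T / (2 * mR d) - 2 * 2 ^ J) = (A - 1) * (P.T / (2 * mR d)) - (A - 1) * (2 * 2 ^ J) := by ring
    rw [htot]
    have : P.𝔘 / 4 - P.𝔘 / 2 ^ 86 - P.𝔘 / 2 ^ 16 - P.𝔘 / 2 ^ 13 ≥ P.𝔘 / 5 := by nlinarith
    linarith [ha, hb, hc1, hc2, hc3, hc4, hWs, hd]
  -- positivity of the bracket, then the product bound
  have hX : 0 < P.T / (2 * mR d) - 2 * 2 ^ J := by
    by_contra hneg
    push Not at hneg
    have : (A - 1) * (P.T / (2 * mR d) - 2 * 2 ^ J) ≤ 0 := mul_nonpos_of_nonneg_of_nonpos (by linarith) hneg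
    linarith [hU]
  have hk1 : 2 ^ k * (A - 1) * 2 ^ J ≤ ((2 ^ (k + J) * P.S₀ / 2 : ℕ) : ℝ) := by
    have : (2 : ℝ) ^ k * (A - 1) * 2 ^ J = 2 ^ (k + J) * (A - 1) := by rw [pow_add]; ring
    rw [this]; exact h1
  calc (2 : ℝ) ^ k * P.𝔘 / 5 = 2 ^ k * (P.𝔘 / 5) := by ring
    _ ≤ 2 ^ k * ((A - 1) * (P.T / (2 * mR d) - 2 * 2 ^ J)) := by gcongr
    _ ≤ 2 ^ k * ((A - 1) * (2 ^ J * (P.tJ J : ℝ))) := by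
        have hA0 : 0 ≤ A - 1 := by linarith
        have h2k : (0 : ℝ) ≤ 2 ^ k := by positivity
        exact mul_le_mul_of_nonneg_left (mul_le_mul_of_nonneg_left h2' hA0) h2k
    _ = (2 ^ k * (A - 1) * 2 ^ J) * (P.tJ J : ℝ) := by ring
    _ ≤ ((2 ^ (k + J) * P.S₀ / 2 : ℕ) : ℝ) * (P.tJ J : ℝ) := mul_le_mul_of_nonneg_right hk1 ht0

/-! ### Cost and gain of the interpolation -/

omit P in
/-- `28 e ≤ e^{4.34}`. [folklore] -/
theorem twentyeight_e_le : 28 * Real.exp 1 ≤ Real.exp 4.34 := by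
  have h1 := Real.exp_one_lt_d9
  have h2 : Real.exp 4.34 = Real.exp 1 * Real.exp 3.34 := by rw [← Real.exp_add]; norm_num
  have h3 : (28 : ℝ) ≤ Real.exp 3.34 := by
    -- `e^{3.34} ≥ 2.718^{3} · e^{0.34} ≥ 20.08 · 1.4049`
    have h4 : Real.exp 3.34 = Real.exp 1 ^ 3 * Real.exp 0.34 := by
      rw [← Real.exp_nat_mul, ← Real.exp_add]; norm_num
    have h5 : (1.34 : ℝ) + 0.34 ^ 2 / 2 ≤ Real.exp 0.34 := by
      have := Real.quadratic_le_exp_of_nonneg (show (0 : ℝ) ≤ 0.34 by norm_num); linarith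
    have h6 := Real.exp_one_gt_d9
    rw [h4]
    have h7 : (2.7182818283 : ℝ) ^ 3 ≤ Real.exp 1 ^ 3 := by gcongr
    nlinarith [h7, h5]
  rw [h2]; nlinarith [Real.exp_pos 1, Real.exp_pos 3.34]

/-- **The Hermite cost `(28e)^{kpts · t_J} ≤ exp(1.085 · 2ᵏ 𝔘)`.** [cite: Waldschmidt1980, Lemma 3.5 (p. 271)] -/
theorem cost_le (J k : ℕ) :
    (28 * Real.exp 1) ^ ((2 ^ (k + J) * P.S₀ / 2) * P.tJ J) ≤ Real.exp (1.085 * (2 ^ k * P.𝔘)) := by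
  have h1 := P.KT_le J k
  calc (28 * Real.exp 1) ^ ((2 ^ (k + J) * P.S₀ / 2) * P.tJ J)
      ≤ (Real.exp 4.34) ^ ((2 ^ (k + J) * P.S₀ / 2) * P.tJ J) :=
        pow_le_pow_left₀ (by positivity) twentyeight_e_le _
    _ = Real.exp (4.34 * (((2 ^ (k + J) * P.S₀ / 2 : ℕ) : ℝ) * (P.tJ J : ℝ))) := by
        rw [← Real.exp_nat_mul]; push_cast; ring_nf
    _ ≤ Real.exp (1.085 * (2 ^ k * P.𝔘)) := by
        apply Real.exp_le_exp.mpr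
        have : (0 : ℝ) ≤ 2 ^ k * P.𝔘 := by have := P.𝔘_pos; positivity
        nlinarith

omit P in
/-- `e³ ≤ 21`. [folklore] -/
theorem exp_three_le : Real.exp 3 ≤ 21 := by
  have := Real.exp_one_lt_d9
  calc Real.exp 3 = Real.exp 1 ^ 3 := by rw [← Real.exp_nat_mul]; norm_num
    _ ≤ (2.7182818286 : ℝ) ^ 3 := by gcongr
    _ ≤ 21 := by norm_num

/-- **The gain `(1/21)^{kpts · t_J} ≤ exp(−0.6 · 2ᵏ 𝔘)`** for `J < J₀`. [cite: Waldschmidt1980, Lemma 3.5 (p. 271)] -/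
theorem gain_le {J : ℕ} (hJ : J < P.J₀) (k : ℕ) :
    ((1 : ℝ) / 21) ^ ((2 ^ (k + J) * P.S₀ / 2) * P.tJ J) ≤ Real.exp (-(0.6 * (2 ^ k * P.𝔘))) := by
  have h1 := P.KT_ge hJ k
  have h21 : (1 : ℝ) / 21 ≤ Real.exp (-3) := by
    rw [Real.exp_neg, one_div]
    exact inv_anti₀ (Real.exp_pos 3) exp_three_le
  calc ((1 : ℝ) / 21) ^ ((2 ^ (k + J) * P.S₀ / 2) * P.tJ J)
      ≤ (Real.exp (-3)) ^ ((2 ^ (k + J) * P.S₀ / 2) * P.tJ J) := pow_le_pow_left₀ (by positivity) h21 _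
    _ = Real.exp (-3 * (((2 ^ (k + J) * P.S₀ / 2 : ℕ) : ℝ) * (P.tJ J : ℝ))) := by
        rw [← Real.exp_nat_mul]; push_cast; ring_nf
    _ ≤ Real.exp (-(0.6 * (2 ^ k * P.𝔘))) := by
        apply Real.exp_le_exp.mpr
        nlinarith

/-- **The growth `exp(Ψ_J · 65 · SK) ≤ exp(2ᵏ 𝔘/100)`** (`Ψ_J ≤ (∑LV+1)/2^J`, `SK = 2^{k+J} S₀`).
[folklore] -/
theorem growth_le (J k : ℕ) :
    Real.exp ((∑ i, (P.Lall i : ℝ) * P.Vall i + 1) / 2 ^ J * (65 * ((2 ^ (k + J) * P.S₀ : ℕ) : ℝ))) ≤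
      Real.exp (2 ^ k * P.𝔘 / 100) := by
  apply Real.exp_le_exp.mpr
  have hΨ : (∑ i, (P.Lall i : ℝ) * P.Vall i + 1) / 2 ^ J * (65 * ((2 ^ (k + J) * P.S₀ : ℕ) : ℝ)) ≤
      65 * 2 ^ k * (P.𝔘 / (2 * cL') + P.S₀) := by
    have h2 : (0 : ℝ) < 2 ^ J := by positivity
    have e1 : (∑ i, (P.Lall i : ℝ) * P.Vall i + 1) / 2 ^ J * (65 * ((2 ^ (k + J) * P.S₀ : ℕ) : ℝ)) =
        65 * 2 ^ k * (P.S₀ * (∑ i, (P.Lall i : ℝ) * P.Vall i) + P.S₀) := by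
      rw [div_mul_eq_mul_div, div_eq_iff h2.ne']; push_cast; rw [pow_add]; ring
    rw [e1]
    have h3 := P.S₀_sum_LV_le
    gcongr
  refine hΨ.trans ?_
  have hS := P.S₀_le; have hmW := P.mW_le_𝔘; have hU := P.𝔘_pos
  have h1 : P.𝔘 / (2 * cL') + P.S₀ ≤ P.𝔘 / 8192 + P.𝔘 / 2 ^ 76 := by
    unfold cL' cS at *
    have : (P.S₀ : ℝ) ≤ P.𝔘 / 2 ^ 76 := by
      rw [le_div_iff₀ (by norm_num)]; nlinarith
    have e : P.𝔘 / (2 * 2 ^ 12) = P.𝔘 / 8192 := by norm_num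
    linarith
  have h2k : (0 : ℝ) ≤ 2 ^ k := by positivity
  calc 65 * 2 ^ k * (P.𝔘 / (2 * cL') + P.S₀) ≤ 65 * 2 ^ k * (P.𝔘 / 8192 + P.𝔘 / 2 ^ 76) := by gcongr
    _ ≤ 2 ^ k * P.𝔘 / 100 := by nlinarith

/-! ### The plugged-in bounds and the final inequalities -/

/-- The height factor `E(c) = exp(c 𝔘/(2c_L'))`. [folklore] -/
def Efac (c : ℝ) : ℝ := Real.exp (c * (P.𝔘 / (2 * cL')))

/-- The bound `Pr = 2 𝔅⁵ E(2)` for the coefficients `p(u)` (`|p| ≤ ⌈#box₀ · 𝔅⁴E(2)⌉`). [folklore] -/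
def PrV : ℝ := 2 * P.𝔅 ^ 5 * P.Efac 2

/-- The growth bound `Ψ_J = (∑ LᵢVᵢ + 1)/2ᴶ` for `|ψ(u)|, |ψ(u) + λ_θΛ₀|` at level `J`. [folklore] -/
def ΨV (J : ℕ) : ℝ := (∑ i, (P.Lall i : ℝ) * P.Vall i + 1) / 2 ^ J

/-- The smallness parameter `x = 𝔅 e^{−U}`. [folklore] -/
def xV : ℝ := P.𝔅 * Real.exp (-P.U)

/-- `Cl = 1 + ∑ Vⱼ ≥ 1 + ∑ |log αⱼ|`. [folklore] -/
def ClV : ℝ := 1 + ∑ j, P.V j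

/-- The bound `B_f = 𝔅 · Pr · (𝔅 · 𝔅 · exp(Ψ_J · 65 · SK))` for `f_{J,τ}` on the far circle,
`SK = 2^{k+J} S₀`. [folklore] -/
def BfV (J k : ℕ) : ℝ := P.𝔅 * P.PrV * (P.𝔅 * P.𝔅 * Real.exp (P.ΨV J * (65 * ((2 ^ (k + J) * P.S₀ : ℕ) : ℝ))))

/-- `ε₉ = B_f · 2x`. [folklore] -/
def ε₉V (J k : ℕ) : ℝ := P.BfV J k * (2 * P.xV)

/-- The quantity `δ` bounded by the interpolation (Lemma 3.5) at level `J`, step `k`. [folklore] -/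
def δV (J k : ℕ) : ℝ :=
  2 * (((2 ^ (k + J) * P.S₀ / 2 : ℕ)) : ℝ) ^ (P.tJ J + 1) * (P.tJ J : ℝ) *
      (28 * Real.exp 1) ^ (2 ^ (k + J) * P.S₀ / 2 * P.tJ J) * ((2 * P.ClV) ^ P.tJ J * P.ε₉V J k) +
    P.BfV J k * (1 / 21) ^ (2 ^ (k + J) * P.S₀ / 2 * P.tJ J) + P.ε₉V J k

omit P in
/-- `a b ≤ exp(x + y)` from `a ≤ exp x`, `b ≤ exp y`, `b ≥ 0`. [folklore] -/
theorem mul_le_exp_add {a b x y : ℝ} (ha : a ≤ Real.exp x) (hb : b ≤ Real.exp y) (hb0 : 0 ≤ b) :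
    a * b ≤ Real.exp (x + y) := by
  rw [Real.exp_add]
  exact mul_le_mul ha hb hb0 (Real.exp_pos x).le

/-- `𝔅ⁿ = exp(n 𝔘/64)`. [folklore] -/
theorem 𝔅_pow (n : ℕ) : P.𝔅 ^ n = Real.exp (n * (P.𝔘 / 64)) := by
  unfold 𝔅; rw [← Real.exp_nat_mul]

omit P in
/-- `2 ≤ e^{0.75}`. [folklore] -/
theorem two_le_exp : (2 : ℝ) ≤ Real.exp 0.75 := by
  have := Real.quadratic_le_exp_of_nonneg (show (0 : ℝ) ≤ 0.75 by norm_num); nlinarith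

/-- `0 ≤ B_f`. [folklore] -/
theorem BfV_nonneg (J k : ℕ) : 0 ≤ P.BfV J k := by
  unfold BfV PrV Efac; have := P.𝔅_pos; positivity

/-- **`B_f ≤ exp(0.75 + 8·𝔘/64 + 2·𝔘/(2c_L') + 2ᵏ𝔘/100)`.** [folklore] -/
theorem BfV_le (J k : ℕ) :
    P.BfV J k ≤ Real.exp (0.75 + 8 * (P.𝔘 / 64) + 2 * (P.𝔘 / (2 * cL')) + 2 ^ k * P.𝔘 / 100) := by
  have hG := P.growth_le J k
  have h𝔅 := P.𝔅_pos
  unfold BfV PrV Efac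
  have e : P.𝔅 * (2 * P.𝔅 ^ 5 * Real.exp (2 * (P.𝔘 / (2 * cL')))) *
      (P.𝔅 * P.𝔅 * Real.exp (P.ΨV J * (65 * ((2 ^ (k + J) * P.S₀ : ℕ) : ℝ)))) =
      2 * (P.𝔅 ^ 8 * Real.exp (2 * (P.𝔘 / (2 * cL'))) * Real.exp (P.ΨV J * (65 * ((2 ^ (k + J) * P.S₀ : ℕ) : ℝ)))) := by
    ring
  rw [e, P.𝔅_pow]
  unfold ΨV at hG ⊢
  calc 2 * (Real.exp ((8 : ℕ) * (P.𝔘 / 64)) * Real.exp (2 * (P.𝔘 / (2 * cL'))) *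
        Real.exp ((∑ i, (P.Lall i : ℝ) * P.Vall i + 1) / 2 ^ J * (65 * ((2 ^ (k + J) * P.S₀ : ℕ) : ℝ))))
      ≤ Real.exp 0.75 * (Real.exp ((8 : ℕ) * (P.𝔘 / 64)) * Real.exp (2 * (P.𝔘 / (2 * cL'))) * Real.exp (2 ^ k * P.𝔘 / 100)) := by
        gcongr
        exact two_le_exp
    _ = Real.exp (0.75 + 8 * (P.𝔘 / 64) + 2 * (P.𝔘 / (2 * cL')) + 2 ^ k * P.𝔘 / 100) := by
        simp only [← Real.exp_add]; push_cast; ring_nf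

/-- `0 ≤ ε₉`. [folklore] -/
theorem ε₉V_nonneg (J k : ℕ) : 0 ≤ P.ε₉V J k := by
  unfold ε₉V xV; have := P.BfV_nonneg J k; have := P.𝔅_pos; positivity

/-- **`ε₉ ≤ exp(1.5 + 9·𝔘/64 + 2·𝔘/(2c_L') + 2ᵏ𝔘/100 − U)`.** [folklore] -/
theorem ε₉V_le (J k : ℕ) :
    P.ε₉V J k ≤ Real.exp (1.5 + 9 * (P.𝔘 / 64) + 2 * (P.𝔘 / (2 * cL')) + 2 ^ k * P.𝔘 / 100 - P.U) := by
  have h1 := P.BfV_le J k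
  unfold ε₉V xV
  have h2 : 2 * (P.𝔅 * Real.exp (-P.U)) ≤ Real.exp (0.75 + P.𝔘 / 64 - P.U) := by
    unfold 𝔅
    rw [show (0.75 : ℝ) + P.𝔘 / 64 - P.U = 0.75 + (P.𝔘 / 64 + -P.U) by ring, Real.exp_add, Real.exp_add]
    have := two_le_exp
    have h0 : 0 ≤ Real.exp (P.𝔘 / 64) * Real.exp (-P.U) := by positivity
    nlinarith
  calc P.BfV J k * (2 * (P.𝔅 * Real.exp (-P.U)))
      ≤ Real.exp ((0.75 + 8 * (P.𝔘 / 64) + 2 * (P.𝔘 / (2 * cL')) + 2 ^ k * P.𝔘 / 100) + (0.75 + P.𝔘 / 64 - P.U)) :=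
        mul_le_exp_add h1 h2 (by have := P.𝔅_pos; positivity)
    _ = _ := by ring_nf

/-- The three terms of `δ` against a target `exp r`: if each is `≤ exp(r − 2)` then `δ < exp r`.
[folklore] -/
theorem δV_lt_of {J k : ℕ} (hJ : J < P.J₀) (hk : k ≤ d) {r : ℝ}
    (h1 : 2 * (P.𝔘 / 64) + 1.085 * (2 ^ k * P.𝔘) +
        (1.5 + 9 * (P.𝔘 / 64) + 2 * (P.𝔘 / (2 * cL')) + 2 ^ k * P.𝔘 / 100 - P.U) ≤ r - 2)
    (h2 : (0.75 + 8 * (P.𝔘 / 64) + 2 * (P.𝔘 / (2 * cL')) + 2 ^ k * P.𝔘 / 100) + -(0.6 * (2 ^ k * P.𝔘)) ≤ r - 2)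
    (h3 : 1.5 + 9 * (P.𝔘 / 64) + 2 * (P.𝔘 / (2 * cL')) + 2 ^ k * P.𝔘 / 100 - P.U ≤ r - 2) :
    P.δV J k < Real.exp r := by
  unfold δV
  set kp : ℕ := 2 ^ (k + J) * P.S₀ / 2 with hkp
  set t : ℕ := P.tJ J with ht
  have hε := P.ε₉V_le J k
  have hε0 := P.ε₉V_nonneg J k
  have hB := P.BfV_le J k
  have hB0 := P.BfV_nonneg J k
  -- the factor bounds
  have hpoly : 2 * (kp : ℝ) ^ (t + 1) * (t : ℝ) ≤ Real.exp (P.𝔘 / 64) :=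
    P.two_kpts_pow_le (P.kpts_le_nat hJ.le hk) (P.tJ_le_T J)
  have hCl : (2 * P.ClV) ^ t ≤ Real.exp (P.𝔘 / 64) := P.two_Cl_pow_le (P.tJ_le_T J)
  have hcost : (28 * Real.exp 1) ^ (kp * t) ≤ Real.exp (1.085 * (2 ^ k * P.𝔘)) := P.cost_le J k
  have hgain : ((1 : ℝ) / 21) ^ (kp * t) ≤ Real.exp (-(0.6 * (2 ^ k * P.𝔘))) := P.gain_le hJ k
  have hCl0 : 0 ≤ (2 * P.ClV) ^ t := by
    unfold ClV
    have : 0 ≤ ∑ j, P.V j := sum_nonneg fun j _ => le_trans zero_le_one (P.hV j)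
    positivity
  -- term 1
  have T1 : 2 * (kp : ℝ) ^ (t + 1) * (t : ℝ) * (28 * Real.exp 1) ^ (kp * t) * ((2 * P.ClV) ^ t * P.ε₉V J k) ≤
      Real.exp (r - 2) := by
    have hA : 2 * (kp : ℝ) ^ (t + 1) * (t : ℝ) * (28 * Real.exp 1) ^ (kp * t) ≤
        Real.exp (P.𝔘 / 64 + 1.085 * (2 ^ k * P.𝔘)) := mul_le_exp_add hpoly hcost (by positivity)
    have hBB : (2 * P.ClV) ^ t * P.ε₉V J k ≤
        Real.exp (P.𝔘 / 64 + (1.5 + 9 * (P.𝔘 / 64) + 2 * (P.𝔘 / (2 * cL')) + 2 ^ k * P.𝔘 / 100 - P.U)) :=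
      mul_le_exp_add hCl hε hε0
    have := mul_le_exp_add hA hBB (mul_nonneg hCl0 hε0)
    refine this.trans (Real.exp_le_exp.mpr ?_)
    linarith
  -- term 2
  have T2 : P.BfV J k * ((1 : ℝ) / 21) ^ (kp * t) ≤ Real.exp (r - 2) := by
    have := mul_le_exp_add hB hgain (by positivity)
    exact this.trans (Real.exp_le_exp.mpr (by linarith))
  -- term 3
  have T3 : P.ε₉V J k ≤ Real.exp (r - 2) := hε.trans (Real.exp_le_exp.mpr h3)
  have hsum : Real.exp (r - 2) + Real.exp (r - 2) + Real.exp (r - 2) < Real.exp r := by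
    rw [show r - 2 = r + (-2) by ring, Real.exp_add]
    have he : Real.exp (-2) < 1 / 3 := by
      rw [Real.exp_neg, ← one_div]
      apply one_div_lt_one_div_of_lt (by norm_num)
      have h2 : (3 : ℝ) < Real.exp 2 := by
        have := Real.quadratic_le_exp_of_nonneg (show (0:ℝ) ≤ 2 by norm_num); linarith
      exact h2
    nlinarith [Real.exp_pos r]
  linarith [T1, T2, T3, hsum]

/-- **The final inequality of the inner step `k < d`** (integer points `s₁ < 2^{k+1+J} S₀`,
Liouville against `D ≤ 𝔅² E(2^{k+1})`): `δ < 1/(𝔅² E(2^{k+1}))`.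
[cite: Waldschmidt1980, Lemma 3.6 (p. 272)] -/
theorem final_kstep {J k : ℕ} (hJ : J < P.J₀) (hk : k < d) :
    P.δV J k < 1 / (P.𝔅 ^ 2 * P.Efac ((2 ^ (k + 1) : ℕ) : ℝ)) := by
  have hU := P.𝔘_pos; have hUge := P.𝔘_ge'
  set u := P.𝔘 with hu
  set K := (2 : ℝ) ^ k * P.𝔘 with hK
  have hKu : u ≤ K := by
    rw [hK, hu]; have : (1 : ℝ) ≤ 2 ^ k := one_le_pow₀ (by norm_num); nlinarith
  have hUK : 4 * K ≤ P.U := by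
    rw [hK, P.U_eq]
    have : (2 : ℝ) ^ k * 4 ≤ 2 ^ (d + 1) := by
      calc (2 : ℝ) ^ k * 4 = 2 ^ (k + 2) := by rw [pow_add]; norm_num
        _ ≤ 2 ^ (d + 1) := pow_le_pow_right₀ (by norm_num) (by omega)
    nlinarith
  -- the target `1/(𝔅² E(2^{k+1})) = exp r`
  have er : 1 / (P.𝔅 ^ 2 * P.Efac ((2 ^ (k + 1) : ℕ) : ℝ)) = Real.exp (-(2 * (u / 64) + 2 * K / (2 * cL'))) := by
    rw [P.𝔅_pow]; unfold Efac
    rw [← Real.exp_add, one_div, ← Real.exp_neg]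
    congr 1; push_cast; rw [hK, hu, pow_succ]; ring
  rw [er]
  have hc : (100 : ℝ) ≤ u := le_trans (by norm_num) hUge
  refine P.δV_lt_of hJ hk.le ?_ ?_ ?_
  · unfold cL'; rw [← hu] at *; nlinarith
  · unfold cL'; rw [← hu] at *; nlinarith
  · unfold cL'; rw [← hu] at *; nlinarith

/-- **The final inequality of the half step** (`k = d`, half-integer points, Liouville against
`M/(4 D M P²)^{2ᵐ}` with `M = 𝔅 · Pr · 𝔅²E(2)`, `D = 𝔅²E(2)`, `P ≤ exp(∑ Vallᵢ)`).
[cite: Waldschmidt1980, Lemma 3.7 (pp. 272–273)] -/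
theorem final_half {J : ℕ} (hJ : J < P.J₀) {hP : ℝ} (hP1 : 1 ≤ hP) (hPle : hP ≤ Real.exp (∑ i, P.Vall i)) :
    P.δV J d < (P.𝔅 * P.PrV * (P.𝔅 ^ 2 * P.Efac 2)) /
      (4 * (P.𝔅 ^ 2 * P.Efac 2) * (P.𝔅 * P.PrV * (P.𝔅 ^ 2 * P.Efac 2)) * hP ^ 2) ^ (2 ^ (d + 1)) := by
  have hU := P.𝔘_pos; have hUge := P.𝔘_ge'; have h𝔅 := P.𝔅_pos
  set u := P.𝔘 with hu
  set K := (2 : ℝ) ^ d * P.𝔘 with hK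
  have hUK : P.U = 2 * K := by rw [hK, P.U_eq, pow_succ]; ring
  have hKu : u ≤ K := by
    rw [hK, hu]; have : (1 : ℝ) ≤ 2 ^ d := one_le_pow₀ (by norm_num); nlinarith
  -- `M ≥ 1`, `base ≥ 1`
  set M := P.𝔅 * P.PrV * (P.𝔅 ^ 2 * P.Efac 2) with hM
  have h𝔅1 := P.one_le_𝔅
  have hE1 : ∀ c : ℝ, 0 ≤ c → 1 ≤ P.Efac c := fun c hc => by
    unfold Efac; exact Real.one_le_exp (by unfold cL'; positivity)
  have hPr1 : 1 ≤ P.PrV := by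
    unfold PrV
    have := hE1 2 (by norm_num); have : 1 ≤ P.𝔅 ^ 5 := one_le_pow₀ h𝔅1
    nlinarith
  have hM1 : 1 ≤ M := by
    rw [hM]
    have h2 : 1 ≤ P.𝔅 ^ 2 * P.Efac 2 := one_le_mul_of_one_le_of_one_le (one_le_pow₀ h𝔅1) (hE1 2 (by norm_num))
    exact one_le_mul_of_one_le_of_one_le (one_le_mul_of_one_le_of_one_le h𝔅1 hPr1) h2
  set base := 4 * (P.𝔅 ^ 2 * P.Efac 2) * M * hP ^ 2 with hbase
  have hbase1 : 1 ≤ base := by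
    rw [hbase]
    have h2 : 1 ≤ P.𝔅 ^ 2 * P.Efac 2 := one_le_mul_of_one_le_of_one_le (one_le_pow₀ h𝔅1) (hE1 2 (by norm_num))
    have h3 : 1 ≤ hP ^ 2 := one_le_pow₀ hP1
    have h4 : (1 : ℝ) ≤ 4 * (P.𝔅 ^ 2 * P.Efac 2) := by nlinarith
    exact one_le_mul_of_one_le_of_one_le (one_le_mul_of_one_le_of_one_le h4 hM1) h3
  -- `log base ≤ 2.25 + 10 u/64 + 6 u/(2c_L') + 2 u/2^90`
  have hlogbase : Real.log base ≤ 2.25 + 10 * (u / 64) + 6 * (u / (2 * cL')) + 2 * (u / 2 ^ 90) := by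
    have hV := P.sum_Vall_le
    have hb : base ≤ Real.exp (2.25 + 10 * (u / 64) + 6 * (u / (2 * cL')) + 2 * (u / 2 ^ 90)) := by
      rw [hbase, hM]
      unfold PrV
      rw [P.𝔅_pow, P.𝔅_pow]
      unfold 𝔅 Efac
      have h8 : (8 : ℝ) ≤ Real.exp 2.25 := by
        have h7 := two_le_exp
        have : Real.exp 2.25 = Real.exp 0.75 ^ 3 := by rw [← Real.exp_nat_mul]; norm_num
        rw [this]
        calc (8 : ℝ) = 2 ^ 3 := by norm_num
          _ ≤ Real.exp 0.75 ^ 3 := pow_le_pow_left₀ (by norm_num) h7 3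
      have hP2 : hP ^ 2 ≤ Real.exp (2 * (u / 2 ^ 90)) := by
        have : hP ≤ Real.exp (u / 2 ^ 90) := hPle.trans (Real.exp_le_exp.mpr hV)
        calc hP ^ 2 ≤ Real.exp (u / 2 ^ 90) ^ 2 := pow_le_pow_left₀ (by linarith) this 2
          _ = Real.exp (2 * (u / 2 ^ 90)) := by rw [← Real.exp_nat_mul]; norm_num
      have e : 4 * (Real.exp ((2 : ℕ) * (P.𝔘 / 64)) * Real.exp (2 * (P.𝔘 / (2 * cL')))) *
          (Real.exp (P.𝔘 / 64) * (2 * Real.exp ((5 : ℕ) * (P.𝔘 / 64)) * Real.exp (2 * (P.𝔘 / (2 * cL')))) *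
            (Real.exp ((2 : ℕ) * (P.𝔘 / 64)) * Real.exp (2 * (P.𝔘 / (2 * cL'))))) * hP ^ 2 =
          8 * Real.exp (10 * (u / 64) + 6 * (u / (2 * cL'))) * hP ^ 2 := by
        simp only [← hu]
        have : Real.exp (10 * (u / 64) + 6 * (u / (2 * cL'))) =
            Real.exp ((2 : ℕ) * (u / 64)) * Real.exp (2 * (u / (2 * cL'))) * (Real.exp (u / 64) * (Real.exp ((5 : ℕ) * (u / 64)) *
              Real.exp (2 * (u / (2 * cL')))) * (Real.exp ((2 : ℕ) * (u / 64)) * Real.exp (2 * (u / (2 * cL'))))) := by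
          simp only [← Real.exp_add]; push_cast; ring_nf
        rw [this]; ring
      rw [e]
      calc 8 * Real.exp (10 * (u / 64) + 6 * (u / (2 * cL'))) * hP ^ 2
          ≤ Real.exp 2.25 * Real.exp (10 * (u / 64) + 6 * (u / (2 * cL'))) * Real.exp (2 * (u / 2 ^ 90)) := by
            gcongr
        _ = Real.exp (2.25 + 10 * (u / 64) + 6 * (u / (2 * cL')) + 2 * (u / 2 ^ 90)) := by
            simp only [← Real.exp_add]; ring_nf
    calc Real.log base ≤ Real.log (Real.exp (2.25 + 10 * (u / 64) + 6 * (u / (2 * cL')) + 2 * (u / 2 ^ 90))) :=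
          Real.log_le_log (by linarith) hb
      _ = _ := Real.log_exp _
  -- `RHS ≥ exp(−2^{d+1} log base)`
  have hRHS : Real.exp (-(2 ^ (d + 1) * (2.25 + 10 * (u / 64) + 6 * (u / (2 * cL')) + 2 * (u / 2 ^ 90)))) ≤ M / base ^ (2 ^ (d + 1)) := by
    have hb0 : 0 < base := by linarith
    rw [le_div_iff₀ (pow_pos hb0 _)]
    have h1 : base ^ (2 ^ (d + 1)) = Real.exp ((2 ^ (d + 1) : ℕ) * Real.log base) := by
      rw [Real.exp_nat_mul, Real.exp_log hb0]
    rw [h1, ← Real.exp_add]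
    calc Real.exp (-(2 ^ (d + 1) * (2.25 + 10 * (u / 64) + 6 * (u / (2 * cL')) + 2 * (u / 2 ^ 90))) + ((2 ^ (d + 1) : ℕ) : ℝ) * Real.log base)
        ≤ Real.exp 0 := by
          apply Real.exp_le_exp.mpr
          push_cast
          have h2 : (0 : ℝ) ≤ 2 ^ (d + 1) := by positivity
          nlinarith [mul_le_mul_of_nonneg_left hlogbase h2]
      _ = 1 := Real.exp_zero
      _ ≤ M := hM1
  refine lt_of_lt_of_le ?_ hRHS
  have hc : (100 : ℝ) ≤ u := le_trans (by norm_num) hUge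
  have hd2 : (2 : ℝ) ^ (d + 1) * 100 ≤ K := by
    rw [hK, pow_succ]
    have : (2 : ℝ) * 100 ≤ P.𝔘 := by linarith
    have h0 : (0 : ℝ) ≤ 2 ^ d := by positivity
    nlinarith
  have e2 : (2 : ℝ) ^ (d + 1) * u = 2 * K := by rw [hK, hu, pow_succ]; ring
  refine P.δV_lt_of hJ le_rfl ?_ ?_ ?_
  · unfold cL'; rw [← hu, hUK] at *; rw [← hK]; nlinarith [e2, hd2, hKu, hc]
  · unfold cL'; rw [← hu] at *; rw [← hK]; nlinarith [e2, hd2, hKu, hc]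
  · unfold cL'; rw [← hu, hUK] at *; rw [← hK]; nlinarith [e2, hd2, hKu, hc]

end Literature.NumberTheory.Transcendental.Waldschmidt1980.W80Par

end
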